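import Literature.MathematicalPhysics.QuantumFieldTheory.Balaban1983to89.B9B8KnitTorusSocketThreshold
import Literature.MathematicalPhysics.QuantumFieldTheory.Balaban1983to89.B9B8KnitTorusSocketLevelZero
import Literature.MathematicalPhysics.QuantumFieldTheory.Balaban1983to89.B9Thm33SocketUniformLevelsZdPer

/-!
# `Balaban1983to89.B9B8KnitTorusSocketAllLevels` — T. Bałaban, *Propagators and renormalization transformations for lattice gauge theories. I*, Commun.
# Math. Phys. **95** (1984) 17–40 [Balaban1985RegularSpaces], Thm 2 p. 83, (1.58)–(1.60) pp. 86–87, Prop. 3 p. 87, p. 77 («we admit the case when some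
# domains Ω_j are equal to T_η»); *Propagators for lattice gauge theories in a background field*, CMP **99** (1985) 389–434
# [Balaban1985BackgroundPropagators], Thm 3.3 p. 399, (3.41) p. 397, (3.69) p. 404, Thm 3.11 p. 416: **THE [B8] THM 2 TORUS ASSEMBLER's (B)-ARROW
# HYPOTHESIS `∀ m′ ≤ K′, SockB9P3Per P₀ L B* C* c_P 0 len η m′ {ℤ^{d+1}} torusLam torusLamb` AT ONE CONSTANT SET, FROM THE PER-MEMBER Δ_a-SIDE DATA** — the
# (B)-line bond junction, file F9 (the assembly of F7 `B9B8KnitTorusSocketThreshold`, F8 `B9B8KnitTorusSocketLevelZero` and pub-ymgap's monotonicity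
# `B9Thm33SocketUniformLevelsZdPer.sockB9P3Per_mono`).

statement-level skeleton of published theorems with citation tags; proofs where landed; nothing here is a claim about the Yang–Mills mass gap

THE TARGET SHAPE.  Sub-row G-B8-T2S file A17 `B8Thm2T3FamilyBinderSockPer.hThm2_of_core_sockPer` displays the (B)-arrow of [B8] Theorem 2 on the torus as
`∀ m′ ≤ K − n, SockB9P3Per P₀ L B₀ B₀β c_P β_H len η m′ {ℤ^{d+1}} torusLam torusLamb` with ONE constant set `(B₀, B₀β, c_P, β_H, len)` fixed before the torus,
the member and the truncation.  THIS FILE delivers exactly that family (at `β_H = 0`) from PER-MEMBER data: a family `mem m′` (`1 ≤ m′ ≤ K′`) of k-level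
members of the shape of record (constant level `m′`, `k = m′ + 1`, `c_f = L^{m′+1}`, the weights of record, period `P₀`; `L^{K′} ∣ P₀`), the six Δ_a-SIDE
members (1)–(6) of file 8c's binder at every `mem m′` with a uniform `B₀` (def-Y's Thm 3.3 ∕ 3.11 ∕ Cor 3.6 data at the knit's letters — the G-B9-LETTERS road,
DISPLAYED), a threshold `a_T` in the windows `0 < a_T ≤ α_Q∕L²`, `C₀(d+1)a_T ≤ 1∕3`, `2a_T ≤ c₂′`, and F7's member-uniform numeric condition
`2·(48(d+1) + 14d·M + 32(d+2)² + 12(d+1)²·K₁·C_τβ_τ)·a_T·B₀ ≤ 1`.  Truncation `m′ = 0` is F8's elementary member; truncations `m′ ≥ 1` are F7's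
`sockB9P3Per_torusIdx_of_deltaASide_unif` at `mem m′`; the two constant sets are joined by `sockB9P3Per_mono` into
`B* = max (max 1 (4B₀·max 1 q_Q)) (max 2 (4(d+1)))`, `C* = max (2·max 0 (4B₀)·max 1 q_Q) 4`, `c_P = min (1∕16) (min a_T (min a_T (1∕(4B₀·14d·M + 1))))`.

WHAT THIS FILE PROVES (one `theorem`; 0 `def`, 0 new named facts, 0 `sorry`; standard axioms; fibre `M_N(ℂ)`, `τ = tr`, `letI : CStarAlgebra (Matrix (Fin N)
(Fin N) ℂ) := {}` as in file 8c): ★★★ `sockB9P3Per_torus_allLevels_of_deltaASide`.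

HONEST FRAMING.  Packaging only; the Δ_a-side members per member (and the member family's shape data, which the catalogue
`B8Thm2TorusMemberCatalogue` ∕ A17's `hcat` provide for `.k`, `.cf`, `levY` and which remain displayed for `D.lev`, `w`, the period) REMAIN DISPLAYED; no
estimate of [B8] ∕ [B9] beyond the cited tree theorems; nothing of A17's, pub-ymgap's or the lane's files is modified; `stub_PV3A` NOT discharged; counts
unmoved; one finite 𝕋⁴ programme at fixed ε, Bałaban AS PRINTED; the YM mass gap (Clay) is NOT proved by any of this — nothing continuum ∕ ℝ⁴ ∕ OS.  Cell
`lit-balaban`, seat t2s-1 g8 («B8 §3 Thm 2 TORUS SUPPLIER», (B)-line bond junction); `--supports stmt-QuantumFields-19200`.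

References: T. Bałaban, CMP 95 (1984) 17–40 [Balaban1985RegularSpaces] Thm 2 p.83, p.77, (1.58)–(1.60) pp.86–87, Prop. 3 p.87; CMP 99 (1985) 389–434
[Balaban1985BackgroundPropagators] (3.41) p.397, Thm 3.3 p.399, (3.69) p.404, Thm 3.11 p.416.
-/

noncomputable section

namespace Literature.MathematicalPhysics.QuantumFieldTheory.Balaban1983to89.B9B8KnitTorusSocketAllLevels

open scoped BigOperators
open Node00
open B7Prop1Explicit renaming Site → LSite
open B7Prop2Explicit (unitaryUnits C0 c2')
open B6KLevelCensusIndexV1 (KIdx)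
open B6GlobalChartV1 (PV)
open B8Ineq132 (InAk)
open B8LeafModelZd (ZdIdx)
open B8LeafModelZd3SockPer (SockB9P3Per)
open B8Thm4TorusAt (torusLam)
open B8Thm2TorusMember (TorusMember torusIdx torusLamb)
open B9B8AveragingJunction (parKnitY)
open B8Thm2TorusLettersPerOfKnit (bgY)
open B9SupplySockB9P3ZdLetters (OpsZd)
open B9Eq316AveragingTransposeZd (qQ betaTau alphaQ)
open B9B8KnitTorusSocketThreshold (sockB9P3Per_torusIdx_of_deltaASide_unif)
open B9B8KnitTorusSocketLevelZero (sockB9P3Per_torus_levelZero)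
open B9Thm33SocketUniformLevelsZdPer (sockB9P3Per_mono)
open T4TermwiseTorus (IsPeriodic)

variable {d ℓ : ℕ} {hd : 1 ≤ d + 1} {hL : Odd (ℓ + 1) ∧ 1 < ℓ + 1} {b₀ b₁ : ℝ}

section Matrix

open scoped Matrix Matrix.Norms.L2Operator

variable {N : ℕ} [NeZero N]

/-- ★★★ **THE [B8] THM 2 TORUS ASSEMBLER's (B)-ARROW HYPOTHESIS FROM THE PER-MEMBER Δ_a-SIDE DATA.**  For one torus of period `P₀` with `L^{K′} ∣ P₀`, a
family of k-level members `mem m′` (`1 ≤ m′ ≤ K′`) of the shape of record (constant level `m′`, `k = m′ + 1`, `c_f = L^{m′+1}`, the weights of record, period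
`P₀`), a threshold `a_T` in the windows and ONE member-uniform numeric condition (F7), the Δ_a-side members (1)–(6) at every `mem m′` (uniform `B₀`) give the
socket at EVERY truncation `m′ ≤ K′` — `m′ = 0` by F8, `m′ ≥ 1` by F7 — at ONE constant set
`B* = max (max 1 (4B₀·max 1 q_Q)) (max 2 (4(d+1)))`, `C* = max (2·max 0 (4B₀)·max 1 q_Q) 4`, `c_P = min (1∕16) (min a_T (min a_T (1∕(4B₀·14d·M + 1))))`, `β = 0`
(pub-ymgap's `sockB9P3Per_mono`): EXACTLY the shape `∀ m′ ≤ K − n, SockB9P3Per P₀ L B* C* c_P 0 len η m′ {ℤ^{d+1}} torusLam torusLamb` of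
`B8Thm2T3FamilyBinderSockPer.hThm2_of_core_sockPer`.
[cite: Balaban1985RegularSpaces, Thm 2 p.83, (1.58)–(1.60) pp.86–87, Prop. 3 p.87, p.77 («Ω_j = T_η»); Balaban1985BackgroundPropagators, Thm 3.3 p.399, (3.41) p.397, (3.69) p.404, Thm 3.11 p.416] -/
theorem sockB9P3Per_torus_allLevels_of_deltaASide (hd2 : 2 ≤ d + 1) (hL1 : 1 ≤ ℓ + 1)
    (τ : Matrix (Fin N) (Fin N) ℂ →ₗ[ℂ] ℂ) (hτ : ∀ a, τ a = Matrix.trace a) (hτt : ∀ a b, τ (a * b) = τ (b * a))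
    {Cτ : ℝ} (hCτ : ∀ x y : Matrix (Fin N) (Fin N) ℂ, |(τ (star x * y)).re| ≤ Cτ * ‖x‖ * ‖y‖)
    {P₀ K' : ℕ} (hdvd : (ℓ + 1) ^ K' ∣ P₀) {η : ℝ} (hη : 0 < η) {k : ℕ} (hk : 1 ≤ k)
    (mem : ℕ → KIdx d ℓ hd hL b₀ b₁)
    (hshape : ∀ m', 1 ≤ m' → m' ≤ K' →
      (∀ x, (mem m').D.lev x = m') ∧ (mem m').k = m' + 1 ∧ (∀ z : SiteY (mem m'), levY (mem m') z = m') ∧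
      (∀ ι : IBondY (mem m'), (mem m').w ι =
        (mem m').cf ^ 2 * (((((ℓ + 1 : ℕ) : ℝ)) ^ (ι.1.1 : ℕ)) ^ (d + 1) * (1 / (((ℓ + 1 : ℕ) : ℝ)) ^ (ι.1.1 : ℕ)) ^ 2)) ∧
      (mem m').cf = (((ℓ + 1 : ℕ) : ℝ)) ^ (m' + 1) ∧ (PV d ℓ (mem m').m (mem m').K hd hL).sitesPerDir 0 = P₀)
    (ops₀ : ℝ → ZdIdx (d + 1) (ℓ + 1) → ℕ →
      (letI : CStarAlgebra (Matrix (Fin N) (Fin N) ℂ) := {}; OpsZd (d + 1) (Matrix (Fin N) (Fin N) ℂ)))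
    {M : ℝ} (hM1 : 1 ≤ M) {B₀ aT : ℝ} (hB₀ : 0 < B₀) (haT : 0 < aT) (haTQ : aT ≤ alphaQ (d + 1) (ℓ + 1) / ((ℓ + 1 : ℕ) : ℝ) ^ 2)
    (haT3 : C0 (d + 1) * aT ≤ 1 / 3) (haT2 : 2 * aT ≤ c2' (d + 1) (ℓ + 1))
    (hεB : 2 * ((48 * ((d : ℝ) + 1) + 14 * d * M + (32 * ((d : ℝ) + 2) ^ 2 +
        12 * ((d : ℝ) + 1) ^ 2 * (13344 * ((d : ℝ) + 1) * ((d : ℝ) + 2) ^ 2 * ((d : ℝ) + 5) * (((ℓ + 1 : ℕ) : ℝ)) ^ (d + 4)) *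
          (Cτ * (letI : CStarAlgebra (Matrix (Fin N) (Fin N) ℂ) := {}; betaTau τ)))) * aT) * B₀ ≤ 1)
    (hΔ : letI : CStarAlgebra (Matrix (Fin N) (Fin N) ℂ) := {}
      ∀ m', 1 ≤ m' → m' ≤ K' →
      ∀ (α₀ : ℝ) (U₀ : LSite (d + 1) → Fin (d + 1) → (Matrix (Fin N) (Fin N) ℂ)ˣ),
      (∀ x κ, U₀ x κ ∈ B7Prop2Explicit.unitaryUnits (Matrix (Fin N) (Fin N) ℂ)) →
      IsPeriodic P₀ U₀ → 0 < α₀ → α₀ ≤ aT →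
      InAk (ℓ + 1) m' η α₀ (fun _ => (Set.univ : Set (LSite (d + 1)))) U₀ →
        IsUnit (deltaAY (mem m') (parKnitY (mem m')) (parBY (mem m')) (GpY (mem m') (parKnitY (mem m'))) (bgY (mem m') U₀)) ∧
        (∀ F, wNormBY (mem m') (-1) (GAY (mem m') (parKnitY (mem m')) (parBY (mem m')) (GpY (mem m') (parKnitY (mem m'))) (bgY (mem m') U₀) F) ≤
          B₀ * wNormBY (mem m') (-3) F) ∧
        (∀ F ν, wNormBY (mem m') (-2) (cdB (mem m') (bgY (mem m') U₀) ν
          (GAY (mem m') (parKnitY (mem m')) (parBY (mem m')) (GpY (mem m') (parKnitY (mem m'))) (bgY (mem m') U₀) F)) ≤ B₀ * wNormBY (mem m') (-3) F) ∧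
        (∀ F, wNormBY (mem m') (-3) (lapB (mem m') (bgY (mem m') U₀)
          (GAY (mem m') (parKnitY (mem m')) (parBY (mem m')) (GpY (mem m') (parKnitY (mem m'))) (bgY (mem m') U₀) F)) ≤ B₀ * wNormBY (mem m') (-3) F) ∧
        IsUnit (deltaPrimeAY (mem m') (parKnitY (mem m')) (bgY (mem m') U₀)) ∧
        IsUnit (XY (mem m') (parKnitY (mem m')) (GpY (mem m') (parKnitY (mem m'))) (bgY (mem m') U₀)))
    (len : LSite (d + 1) → ℝ) :
    letI : CStarAlgebra (Matrix (Fin N) (Fin N) ℂ) := {}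
    ∀ m', m' ≤ K' →
      SockB9P3Per (𝔸 := Matrix (Fin N) (Fin N) ℂ) P₀ (ℓ + 1)
        (max (max 1 (2 * (2 * B₀) * max 1 (qQ (d + 1) (ℓ + 1) Cτ (betaTau τ) 0))) (max 2 (4 * ((d + 1 : ℕ) : ℝ))))
        (max (2 * max 0 (2 * (2 * B₀)) * max 1 (qQ (d + 1) (ℓ + 1) Cτ (betaTau τ) 0)) 4)
        (min (1 / 16) (min aT (min aT (1 / (2 * (2 * B₀) * (14 * ((d + 1 - 1 : ℕ) : ℝ)) * M + 1)))))
        0 len η m' (fun _ => (Set.univ : Set (LSite (d + 1)))) (fun m => torusLam (d := d + 1) m) (fun m => torusLamb (d := d + 1) m) := by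
  letI : CStarAlgebra (Matrix (Fin N) (Fin N) ℂ) := {}
  intro m' hm'
  rcases Nat.eq_zero_or_pos m' with h0 | hpos
  · subst h0
    exact sockB9P3Per_torus_levelZero P₀ (ℓ + 1) ((le_max_left _ _).trans (le_max_right _ _))
      ((le_max_right _ _).trans (le_max_right _ _)) (le_max_right _ _) _ len hη
  · obtain ⟨hD, hkn, hlev, hw, hcf, hP⟩ := hshape m' hpos hm'
    have hdvd' : (ℓ + 1) ^ m' ∣ (PV d ℓ (mem m').m (mem m').K hd hL).sitesPerDir 0 := by
      rw [hP]; exact (Nat.pow_dvd_pow _ hm').trans hdvd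
    have hΔ' := hΔ m' hpos hm'
    have hS := sockB9P3Per_torusIdx_of_deltaASide_unif (mem m') hd2 hL1 τ hτ hτt hCτ hD hkn hlev hpos hw hcf hη hk hdvd' ops₀ hM1 hB₀ haT
      haTQ haT3 haT2 hεB (fun α₀ U₀ hU₀ hper hα₀ hα₀T hAk => hΔ' α₀ U₀ hU₀ (by rwa [hP] at hper) hα₀ hα₀T hAk) len
    rw [hP] at hS
    exact sockB9P3Per_mono (le_max_left _ _) (le_max_left _ _) le_rfl hη.le hS

end Matrix

end Literature.MathematicalPhysics.QuantumFieldTheory.Balaban1983to89.B9B8KnitTorusSocketAllLevels
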